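import Summits.QuantumFields.YangMills.Theses.RectangleDomination
import Summits.QuantumFields.YangMills.Theorems.RectangleDominationShallowEngine
import Summits.QuantumFields.YangMills.Theorems.SmallFieldWideningLargeFieldMassRefinementTailOfFirstExit
import Summits.QuantumFields.YangMills.Theorems.FirstExitWindowOneStepWindowL

/-!
# Route `RectangleDomination` (LINE 17 of seat `ym-r3-idea-2`; rung R3 of LADDER-YM = `T3YM3TorusStatement.YM3TorusSU2`, a
# RECORD rung — not d = 4, not the Clay statement) — THE GLUE `HistoryTailOfRectanglesL` (support item
# stmt-QuantumFields-23867), PROVED: `RectangleTailL → ShallowRectangleDominationL → DeepWindowTailL → UnitScaleTilt.HistoryTailL`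

THE ARGUMENT (all bookkeeping; every door is a landed tree theorem).  Fix `L` and a floor `(b₁, p₁)`; take the constants
`(α, c, C, A)` of the rectangle tail and `(C₃, R, η₀)` of the shallow domination at `L`, and the profile `b₀ = max b₁ 1`,
`p₀ = max p₁ (max 3 (3/2 + 1/α))` (so `α(2p₀ − 3) ≥ 2`: the stretched exponent `α` is paid by the profile exponent, [King1986] (3.12)
leaves the profile free).  Thresholds: the proved window ✓`firstExitWindow_oneStepWindowL_proof` (`b₂`, `γ_W`), the deep residual
`DeepWindowTailL` at `N₁ = 3` (`γ_D`), and the side condition of the domination (`γ_S`, part 1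
`exists_gamma_sqrt_pow_mul_θBal_le`); `γ₁ = min γ_W (min γ_D γ_S)` serves every free top fraction `1/m`.  For a family `F` with
`F.L = L` and `0 < γ ≤ γ₁`: a configuration outside Bałaban's small-history event has a least bad height `j*`
(✓`HistoryTailOfTwoSided`); `j* = 0` is the bare term ✓`T3BareTailProfile.bareTailAt`; at `1 ≤ j*` with `3j* ≤ K` (SHALLOW) the
bare event of the offending plaquette is bounded by part 2 ✓`RectangleDominationShallow.shallow_perPlaquette` (contrapositive of
the domination + union over rectangles + rectangle tail ⇒ log-square rate = Gaussian profile `(1,1)`); at `K < 3j*` (DEEP) the window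
puts `Ū^{j*}` in the `b₂`-window and `DeepWindowTailL` bounds the first-exit event (✓`LargeFieldMassRefinementTailOfFirstExit.
real_finestBad_le_card_mul`); the plaquette count and the per-height arithmetic ✓`HistoryTailOfTwoSided.exists_perHeight_bound` (at
the profiles `(1,1)` and `(b₀,p₀)`) give a geometric finest-bad-level profile `(A'_s + A'_d)·2^{−(K−j)}`, and
✓`HistoryTailOfTwoSided.historyTailAt_of_bare_finestBad` gives `HistoryTailAt F γ b₀ p₀ m`.

HONEST FRAMING: this closes the route's SUPPORT item only.  The cruxes `RectangleTailL` (stmt-QuantumFields-23864, XL),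
`ShallowRectangleDominationL` (stmt-QuantumFields-23865, L) and the organ-class residual `DeepWindowTailL` (stmt-QuantumFields-22892)
stay OPEN, as do the parent route's residuals (stmt-19200, stmt-20520); `HistoryTailL` (stmt-19936) stays open behind them.  Rung R3
(`YM3TorusSU2`, SU(2) Yang–Mills on finite three-tori) is a RECORD rung — not d = 4, not the continuum Clay problem; the Yang–Mills
mass gap is NOT proved by any of this.  No `def`, no `sorry`.

References: T. Bałaban, CMP **102** (1985) 255–275 [Balaban1985UV3] ((7) p.257, (71) p.273); C. King, CMP **103** (1986) 323–349
[King1986] ((3.12)); J. Fröhlich, R. Israel, E. Lieb, B. Simon, CMP **62** (1978) 1–34 [FrohlichIsraelLiebSimon1978] (chessboard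
estimate behind the bare term).
-/

set_option autoImplicit false

noncomputable section

open MeasureTheory
open scoped BigOperators
open Literature.MathematicalPhysics.QuantumFieldTheory.Balaban1983to89
open Literature.MathematicalPhysics.QuantumFieldTheory.Balaban1983to89.T3ContinuumYM3Torus
open Literature.MathematicalPhysics.QuantumFieldTheory.Balaban1983to89.T3UnitScaleTilt
open Literature.MathematicalPhysics.QuantumFieldTheory.Balaban1983to89.T3UnitLawDensityEML (ℰp)
open Literature.MathematicalPhysics.QuantumFieldTheory.Balaban1983to89.T3CruxEstimates (real_not_plaqSmall_comp_le_sum)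
open Literature.MathematicalPhysics.QuantumFieldTheory.Balaban1983to89.T3BareTailProfile (bareTailAt)
open Summit.QuantumFields.YangMills.Theorems.HistoryTailOfTwoSided
open Summit.QuantumFields.YangMills.Theorems.LargeFieldMassRefinementTailOfFirstExit (real_finestBad_le_card_mul)
open Summit.QuantumFields.YangMills.Theorems.RectangleDominationShallow

namespace Summit.QuantumFields.YangMills.Theorems

namespace RectangleDominationGlue

/-- **THE FINEST-BAD-LEVEL PROFILE FROM A SHALLOW BARE TAIL AND A DEEP FIRST-EXIT TAIL** (`0 < γ ≤ 1`, `0 < b₀`, `1 ≤ p₀`;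
one family, one coupling).  If the one-step window `θ_{b₀}(K−j)`-small `Ū^{j}` ⇒ `θ_{b₂}(K−j−1)`-small `Ū^{j+1}` holds (every
`j + 1 ≤ K`, every configuration), the BARE per-plaquette events of the shallow heights `3j ≤ K` have mass
`≤ C_s·β_{K−j}^{A_s}·e^{−c_s·p_{1,1}(g_{K−j})²}` and the first-exit (window) events of the deep heights `K < 3j` have mass
`≤ C_d·β_{K−j}^{N_d}·e^{−c_d·p_{b₀,p₀}(g_{K−j})²}` (`c_s, c_d > 0`), then every finest-bad-level event (`1 ≤ j ≤ K`) has Gibbs mass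
`≤ (A'_s + A'_d)·2^{−(K−j)}`: union over the `≤ 9·(2L^{m+K−j})³` plaquettes (`card_plaq_le_pow`; through the window at the deep
heights, `real_finestBad_le_card_mul`) and the per-height arithmetic `exists_perHeight_bound` at the profiles `(1,1)` and
`(b₀,p₀)`. [cite: Balaban1985UV3, (7) p.257 and (71) p.273] -/
theorem exists_finestBad_profile_of_shallow_deep (F : T3Family) {γ b₀ b₂ p₀ : ℝ} (hγ : 0 < γ) (hγ1 : γ ≤ 1)
    (hb₀ : 0 < b₀) (hp₀ : 1 ≤ p₀)
    (hW : ∀ K j : ℕ, j + 1 ≤ K → ∀ U : GaugeField (F.P K) 0 (Matrix.specialUnitaryGroup (Fin 2) ℂ),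
      PlaqSmall (θBal F.L γ b₀ p₀ (K - j))
          (Averaging.iter (fun i => BlockAveraging.blockAvg (P := F.P K) (j := i) ℰp) j U) →
        PlaqSmall (θBal F.L γ b₂ p₀ (K - (j + 1)))
          (Averaging.iter (fun i => BlockAveraging.blockAvg (P := F.P K) (j := i) ℰp) (j + 1) U))
    {Cs cs : ℝ} {As : ℕ} (hCs : 0 ≤ Cs) (hcs : 0 < cs)
    (hS : ∀ K j : ℕ, 3 * j ≤ K → ∀ p : Plaq (F.P K) j, (gibbsK F ℰp γ K).real
      {U | θBal F.L γ b₀ p₀ (K - j) ≤ GaugeGroup.dist1 (GaugeField.plaqHol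
        (Averaging.iter (fun i => BlockAveraging.blockAvg (P := F.P K) (j := i) ℰp) j U) p)} ≤
      Cs * ((γ * ((F.L : ℝ)⁻¹) ^ (K - j))⁻¹) ^ As *
        Real.exp (-(cs * B10.pFun 1 1 (Real.sqrt (γ * ((F.L : ℝ)⁻¹) ^ (K - j))) ^ 2)))
    {Cd cd : ℝ} {Nd : ℕ} (hcd : 0 < cd)
    (hD : ∀ K j : ℕ, 1 ≤ j → j ≤ K → K < 3 * j → ∀ p : Plaq (F.P K) j, (gibbsK F ℰp γ K).real
      {U | (∀ k, k < j → PlaqSmall (θBal F.L γ b₀ p₀ (K - k))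
          (Averaging.iter (fun i => BlockAveraging.blockAvg (P := F.P K) (j := i) ℰp) k U)) ∧
        PlaqSmall (θBal F.L γ b₂ p₀ (K - j))
          (Averaging.iter (fun i => BlockAveraging.blockAvg (P := F.P K) (j := i) ℰp) j U) ∧
        θBal F.L γ b₀ p₀ (K - j) ≤ GaugeGroup.dist1 (GaugeField.plaqHol
          (Averaging.iter (fun i => BlockAveraging.blockAvg (P := F.P K) (j := i) ℰp) j U) p)} ≤
      Cd * ((γ * ((F.L : ℝ)⁻¹) ^ (K - j))⁻¹) ^ Nd *
        Real.exp (-(cd * B10.pFun b₀ p₀ (Real.sqrt (γ * ((F.L : ℝ)⁻¹) ^ (K - j))) ^ 2))) :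
    ∃ A' : ℝ, 0 ≤ A' ∧ ∀ K j : ℕ, 1 ≤ j → j ≤ K → (gibbsK F ℰp γ K).real
      ({U | ¬ PlaqSmall (θBal F.L γ b₀ p₀ (K - j))
          (Averaging.iter (fun i => BlockAveraging.blockAvg (P := F.P K) (j := i) ℰp) j U)} ∩
        {U | ∀ i, i < j → PlaqSmall (θBal F.L γ b₀ p₀ (K - i))
          (Averaging.iter (fun i' => BlockAveraging.blockAvg (P := F.P K) (j := i') ℰp) i U)}) ≤
      A' * ((1 : ℝ) / 2) ^ (K - j) := by
  obtain ⟨As', hAs'0, hPs⟩ := exists_perHeight_bound F hγ hγ1 one_pos le_rfl hCs As hcs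
  obtain ⟨Ad', hAd'0, hPd⟩ := exists_perHeight_bound F hγ hγ1 hb₀ hp₀ (le_max_right Cd 0) Nd hcd
  refine ⟨As' + Ad', add_nonneg hAs'0 hAd'0, fun K j hj1 hjK => ?_⟩
  obtain ⟨j, rfl⟩ : ∃ j', j = j' + 1 := ⟨j - 1, by omega⟩
  haveI := isProbabilityMeasure_gibbsK F ℰp hγ.le K
  have hhalf : 0 ≤ ((1 : ℝ) / 2) ^ (K - (j + 1)) := by positivity
  by_cases hsh : 3 * (j + 1) ≤ K
  · -- SHALLOW: drop the small-history conjunct, union over the plaquettes, the bare tail at the log-square rate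
    have hE0 : 0 ≤ Cs * (F.scheme ℰp γ).β (K - (j + 1)) ^ As *
        Real.exp (-(cs * B10.pFun 1 1 (Real.sqrt (γ * ((F.L : ℝ)⁻¹) ^ (K - (j + 1)))) ^ 2)) :=
      mul_nonneg (mul_nonneg hCs (pow_nonneg (F.scheme_β_nonneg ℰp hγ.le (K - (j + 1))) As)) (Real.exp_nonneg _)
    calc (gibbsK F ℰp γ K).real
          ({U | ¬ PlaqSmall (θBal F.L γ b₀ p₀ (K - (j + 1)))
              (Averaging.iter (fun i => BlockAveraging.blockAvg (P := F.P K) (j := i) ℰp) (j + 1) U)} ∩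
            {U | ∀ i, i < j + 1 → PlaqSmall (θBal F.L γ b₀ p₀ (K - i))
              (Averaging.iter (fun i' => BlockAveraging.blockAvg (P := F.P K) (j := i') ℰp) i U)})
        ≤ (gibbsK F ℰp γ K).real {U | ¬ PlaqSmall (θBal F.L γ b₀ p₀ (K - (j + 1)))
              (Averaging.iter (fun i => BlockAveraging.blockAvg (P := F.P K) (j := i) ℰp) (j + 1) U)} :=
          measureReal_mono Set.inter_subset_left (measure_ne_top _ _)
      _ ≤ ∑ p : Plaq (F.P K) (j + 1), (gibbsK F ℰp γ K).real {U | θBal F.L γ b₀ p₀ (K - (j + 1)) ≤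
            GaugeGroup.dist1 (GaugeField.plaqHol
              (Averaging.iter (fun i => BlockAveraging.blockAvg (P := F.P K) (j := i) ℰp) (j + 1) U) p)} :=
          real_not_plaqSmall_comp_le_sum (gibbsK F ℰp γ K)
            (fun U => Averaging.iter (fun i => BlockAveraging.blockAvg (P := F.P K) (j := i) ℰp) (j + 1) U) _
      _ ≤ ∑ _p : Plaq (F.P K) (j + 1), Cs * (F.scheme ℰp γ).β (K - (j + 1)) ^ As *
            Real.exp (-(cs * B10.pFun 1 1 (Real.sqrt (γ * ((F.L : ℝ)⁻¹) ^ (K - (j + 1)))) ^ 2)) :=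
          Finset.sum_le_sum fun p _ => hS K (j + 1) hsh p
      _ = Fintype.card (Plaq (F.P K) (j + 1)) * (Cs * (F.scheme ℰp γ).β (K - (j + 1)) ^ As *
            Real.exp (-(cs * B10.pFun 1 1 (Real.sqrt (γ * ((F.L : ℝ)⁻¹) ^ (K - (j + 1)))) ^ 2))) := by
          rw [Finset.sum_const, Finset.card_univ, nsmul_eq_mul]
      _ ≤ (9 * (8 * (F.L : ℝ) ^ (3 * F.m) * ((F.L : ℝ) ^ (K - (j + 1))) ^ 3)) *
            (Cs * (F.scheme ℰp γ).β (K - (j + 1)) ^ As *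
              Real.exp (-(cs * B10.pFun 1 1 (Real.sqrt (γ * ((F.L : ℝ)⁻¹) ^ (K - (j + 1)))) ^ 2))) :=
          mul_le_mul_of_nonneg_right (card_plaq_le_pow F hjK) hE0
      _ ≤ As' * ((1 : ℝ) / 2) ^ (K - (j + 1)) := hPs (K - (j + 1))
      _ ≤ (As' + Ad') * ((1 : ℝ) / 2) ^ (K - (j + 1)) :=
          mul_le_mul_of_nonneg_right (le_add_of_nonneg_right hAd'0) hhalf
  · -- DEEP: the window puts `Ū^{j+1}` in the `b₂`-window; the first-exit events are bounded by the deep tail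
    have hKlt : K < 3 * (j + 1) := by omega
    have hE0 : 0 ≤ max Cd 0 * (F.scheme ℰp γ).β (K - (j + 1)) ^ Nd *
        Real.exp (-(cd * B10.pFun b₀ p₀ (Real.sqrt (γ * ((F.L : ℝ)⁻¹) ^ (K - (j + 1)))) ^ 2)) :=
      mul_nonneg (mul_nonneg (le_max_right Cd 0) (pow_nonneg (F.scheme_β_nonneg ℰp hγ.le (K - (j + 1))) Nd))
        (Real.exp_nonneg _)
    have hB : ∀ p : Plaq (F.P K) (j + 1), (gibbsK F ℰp γ K).real
        {U | (∀ k, k < j + 1 → PlaqSmall (θBal F.L γ b₀ p₀ (K - k))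
            (Averaging.iter (fun i => BlockAveraging.blockAvg (P := F.P K) (j := i) ℰp) k U)) ∧
          PlaqSmall (θBal F.L γ b₂ p₀ (K - (j + 1)))
            (Averaging.iter (fun i => BlockAveraging.blockAvg (P := F.P K) (j := i) ℰp) (j + 1) U) ∧
          θBal F.L γ b₀ p₀ (K - (j + 1)) ≤ GaugeGroup.dist1 (GaugeField.plaqHol
            (Averaging.iter (fun i => BlockAveraging.blockAvg (P := F.P K) (j := i) ℰp) (j + 1) U) p)} ≤
        max Cd 0 * (F.scheme ℰp γ).β (K - (j + 1)) ^ Nd *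
          Real.exp (-(cd * B10.pFun b₀ p₀ (Real.sqrt (γ * ((F.L : ℝ)⁻¹) ^ (K - (j + 1)))) ^ 2)) := by
      intro p
      refine (hD K (j + 1) hj1 hjK hKlt p).trans ?_
      show Cd * (F.scheme ℰp γ).β (K - (j + 1)) ^ Nd *
          Real.exp (-(cd * B10.pFun b₀ p₀ (Real.sqrt (γ * ((F.L : ℝ)⁻¹) ^ (K - (j + 1)))) ^ 2)) ≤ _
      exact mul_le_mul_of_nonneg_right
        (mul_le_mul_of_nonneg_right (le_max_left Cd 0) (pow_nonneg (F.scheme_β_nonneg ℰp hγ.le (K - (j + 1))) Nd))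
        (Real.exp_nonneg _)
    refine (real_finestBad_le_card_mul F γ b₀ b₂ p₀ (gibbsK F ℰp γ K) (hW K j hjK) hB).trans ?_
    refine (mul_le_mul_of_nonneg_right (card_plaq_le_pow F hjK) hE0).trans ((hPd (K - (j + 1))).trans ?_)
    exact mul_le_mul_of_nonneg_right (le_add_of_nonneg_left hAs'0) hhalf

end RectangleDominationGlue

open RectangleDominationGlue

/-- **THE GLUE `HistoryTailOfRectanglesL` OF ROUTE `RectangleDomination` (support item stmt-QuantumFields-23867), PROVED**:
`RectangleTailL → ShallowRectangleDominationL → DeepWindowTailL → UnitScaleTilt.HistoryTailL`.  For `L` and a floor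
`(b₁, p₁)`: profile `b₀ = max b₁ 1`, `p₀ = max p₁ (max 3 (3/2 + 1/α))` (`α(2p₀−3) ≥ 2`), thresholds `γ₁ = min γ_W (min γ_D γ_S)`
(proved window, deep residual at `N₁ = 3`, side condition of the domination); for `(F, γ)`: bare term (`bareTailAt`), shallow
heights by `RectangleDominationShallow.shallow_perPlaquette`, deep heights by the window and `DeepWindowTailL`, geometric
finest-bad-level profile (`exists_finestBad_profile_of_shallow_deep`), and `historyTailAt_of_bare_finestBad`.  Nothing here proves
the three tail cruxes, the rung R3, or anything about the mass gap. [cite: Balaban1985UV3, (7) p.257 and (71) p.273] -/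
theorem rectangleDomination_historyTailOfRectanglesL_proof :
    Summit.QuantumFields.YangMills.Theses.RectangleDomination.HistoryTailOfRectanglesL := by
  intro hRT hSD hDW L b₁ p₁
  -- the constants of the two cruxes at block size `L`
  obtain ⟨α, c, C, A, hα, hc, hC, hRTL⟩ := hRT L
  obtain ⟨C₃, R, η₀, hC₃, hR, hη₀, hSDL⟩ := hSD L
  -- the profile: above the floor, `b₀ ≥ 1`, `p₀ ≥ 3`, `α(2p₀ − 3) ≥ 2`
  obtain ⟨b₀, hb₁, hb₀1⟩ : ∃ b₀ : ℝ, b₁ ≤ b₀ ∧ 1 ≤ b₀ := ⟨max b₁ 1, le_max_left _ _, le_max_right _ _⟩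
  obtain ⟨p₀, hp₁, hp₀3, hp₀α⟩ : ∃ p₀ : ℝ, p₁ ≤ p₀ ∧ 3 ≤ p₀ ∧ 3 / 2 + 1 / α ≤ p₀ :=
    ⟨max p₁ (max 3 (3 / 2 + 1 / α)), le_max_left _ _, (le_max_left _ _).trans (le_max_right _ _),
      (le_max_right _ _).trans (le_max_right _ _)⟩
  have hb₀ : 0 < b₀ := one_pos.trans_le hb₀1
  have hp₀ : 2 < p₀ := by linarith
  have hp₀1 : 1 ≤ p₀ := by linarith
  have hαp : 2 ≤ α * (2 * p₀ - 3) := by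
    have h2 : 2 / α ≤ 2 * p₀ - 3 := by
      have : 2 / α = 2 * (3 / 2 + 1 / α) - 3 := by field_simp; ring
      rw [this]; linarith
    calc (2 : ℝ) = α * (2 / α) := by field_simp
      _ ≤ α * (2 * p₀ - 3) := mul_le_mul_of_nonneg_left h2 hα.le
  -- thresholds: the proved window, the deep residual at `N₁ = 3`, the side condition of the domination
  obtain ⟨b₂, γW, hb₂, hγW, hγW1, hW⟩ := firstExitWindow_oneStepWindowL_proof L b₀ p₀ hb₀ hp₀
  obtain ⟨γD, CD, cD, ND, hγD, -, hcD, hD⟩ := hDW L 3 (by norm_num) b₀ p₀ b₂ hb₀ hp₀ hb₂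
  obtain ⟨γS, hγS, -, hS⟩ := exists_gamma_sqrt_pow_mul_θBal_le (b₀ := b₀) (p₀ := p₀) hb₀ (by linarith)
    (ε := 2 * C₃ * min η₀ 1) (by positivity)
  refine ⟨b₀, p₀, hb₁, hp₁, hb₀, hp₀, fun m hm => ⟨min γW (min γD γS), lt_min hγW (lt_min hγD hγS),
    fun F γ hFL hγ hle => ?_⟩⟩
  subst hFL
  have hγW' : γ ≤ γW := hle.trans (min_le_left _ _)
  have hγD' : γ ≤ γD := hle.trans ((min_le_right _ _).trans (min_le_left _ _))
  have hγS' : γ ≤ γS := hle.trans ((min_le_right _ _).trans (min_le_right _ _))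
  have hγ1 : γ ≤ 1 := hγW'.trans hγW1
  have hR0 : 0 < R := by linarith
  -- the bare term (reflection positivity + chessboard, landed)
  obtain ⟨q₀, hq₀0, hq₀, -, hbare⟩ := bareTailAt F hγ hγ1 hb₀ hp₀1
  -- the shallow per-plaquette bare tail at the log-square rate (part 2 of the engine)
  have hcs : 0 < (c * (b₀ ^ 2 / (4 * C₃ ^ 2 * R * (1 + Real.log R)))) ^ α := by
    have hlogR : 0 ≤ Real.log R := Real.log_nonneg (by linarith)
    exact Real.rpow_pos_of_pos (by positivity) α
  have hCs : 0 ≤ 288 * C * (F.L : ℝ) ^ (3 * F.m) * R ^ (A + 2) := by positivity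
  have hshallow := fun (K j : ℕ) (hjK : 3 * j ≤ K) (p : Plaq (F.P K) j) =>
    shallow_perPlaquette F hγ hγ1 hα hc hC hC₃ hR hb₀ hαp (hRTL F γ rfl hγ hγ1) (hSDL F rfl)
      (fun j h hjh => hS F.L F.hL.2.le γ hγ hγS' j h hjh) hjK p
  -- the finest-bad-level profile and the reduction
  obtain ⟨A', hA'0, hfb⟩ := exists_finestBad_profile_of_shallow_deep F hγ hγ1 hb₀ hp₀1 (hW F γ rfl hγ hγW')
    hCs hcs hshallow hcD (hD F γ rfl hγ hγD')
  obtain ⟨hq0, hq, hqt⟩ := geometric_profile hA'0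
  exact historyTailAt_of_bare_finestBad F hγ.le b₀ p₀ hm q₀ (fun i => A' * ((1 : ℝ) / 2) ^ i)
    hq₀0 hq₀ hq0 hq hqt hbare fun K j hj1 hjK => hfb K j hj1 (by omega)

end Summit.QuantumFields.YangMills.Theorems

end
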